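import Summits.ResolutionOfSingularities.ResolutionOfSingularities.Theorems.FrobeniusClosingSteerWords16LowTowerB
import Summits.ResolutionOfSingularities.ResolutionOfSingularities.Theorems.FrobeniusClosingSteerZeroDimPerfect
import Summits.ResolutionOfSingularities.ResolutionOfSingularities.Theorems.FrobeniusClosingSteerSwitchingDefectless
import Summits.ResolutionOfSingularities.ResolutionOfSingularities.Theorems.FrobeniusClosingSteerCore4RunTrichotomy
import Summits.ResolutionOfSingularities.ResolutionOfSingularities.Theorems.FrobeniusClosingSteerCore4OrderOneExit
import Summits.ResolutionOfSingularities.ResolutionOfSingularities.Theorems.FrobeniusClosingSteerCore4Dictionary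
import Summits.ResolutionOfSingularities.ResolutionOfSingularities.Theorems.FrobeniusClosingSteerMaxGenExists
import Summits.ResolutionOfSingularities.ResolutionOfSingularities.Theorems.FrobeniusClosingSteerCore4GenExit
import Summits.ResolutionOfSingularities.ResolutionOfSingularities.Theorems.FrobeniusClosingSteerLogFinalExitM
import Summits.ResolutionOfSingularities.ResolutionOfSingularities.Theorems.FrobeniusClosingSteerSteeredRebase
import Summits.ResolutionOfSingularities.ResolutionOfSingularities.Theorems.WildConesIsolatedForcedTermination
import Literature.AlgebraicGeometry.Resolution.ResolutionLU
import Summits.ResolutionOfSingularities.ResolutionOfSingularities.Theorems.ValuativeLuAlphaPTorsorDimTwo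
import Summits.ResolutionOfSingularities.ResolutionOfSingularities.Theorems.ValuativeLuAlphaPTorsorDenseRangeFinal
import Summits.ResolutionOfSingularities.ResolutionOfSingularities.Theorems.ValuativeLuAlphaPTorsorDiscreteAllDim
import Summits.ResolutionOfSingularities.ResolutionOfSingularities.Theorems.ValuativeLuAlphaPTorsorLowDim
import Summits.ResolutionOfSingularities.ResolutionOfSingularities.Theorems.ValuativeLuAlphaPTorsorKnownRanges
import Summits.ResolutionOfSingularities.ResolutionOfSingularities.Theorems.ValuativeLuAlphaPTorsorChartRegular
import Summits.ResolutionOfSingularities.ResolutionOfSingularities.Theorems.ValuativeLuAlphaPTorsorDimTwoCorollaries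

/-!
# Crux `Steer` (stmt-ResolutionOfSingularities-16345), line `switching-dichotomy` — WORDS 17A: the LANDED-STUB adoption wrappers (`stub_zeroDimPerfect` p166845, `stub_switchingDefectless` p169091, `stub_lu3Perfect_of_cossartPiltant2019LU3`, `stub_core4RunTrichotomy` p473559, `stub_core4OrderOneExit` p479657), the r13/r14 PHASE-MACHINE leaves (`stub_maxGenExists` p496225, `genRebase_holds` p495493, `stub_logFinalExitM` p503597, `stub_logExit`) and the landed range cascade `concl_or_coreDatum` (HOIST of the registered skeleton r43 acbbcc299fb3f591, l.256–259, 261–267, 274–278, 287–292, 301–307, 1280–1350, 1358–1406; RULING 47b: `stub_core4Dictionary` and `isolatedForcedTermination_closed` are NOT hoisted — identical statements already in the tree (`…SwitchingDichotomy.stub_core4Dictionary`, `…FrobeniusClosing.isolatedForcedTermination_of_landed`), they stay as the skeleton's two-line adoptions; the SORRIED `stub_cp2019General` and everything derived from it stay in the skeleton)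

Holder res-L0-w41-lead-1 g5 on res-L0-w41-plan-1 RULING 47 (E1) / 104b; see `…Words01Core` for the hoist protocol (bodies byte for byte;
`[cite: …]` / `[folklore]` tags on CLOSED `def … : Prop` words are written «(ref. …)» / «(folklore)» — GATE NOTE of `…Words02Stubs`;
cite keys inside `[cite:]` tags normalised to `references.bib` keys where needed, as in `…Words03Phases`).
Nothing here is a statement of the manuscript [claim: Hironaka2017, status: under-review]. OURS (candidates / vocabulary; AI review is
weaker than expert review).
-/

open Summit.ResolutionOfSingularities.ResolutionOfSingularities.Theses.FrobeniusClosing (IsolatedForcedTermination)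
open Literature.AlgebraicGeometry.Resolution (IsAbhyankarPlace FGOver exists_ringKrullDim_eq_and_trdeg_eq
  trdeg_eq_trdeg_of_isFractionRing locAtCentre IsQuadraticTransformAlong SubringDominates IsRsopPart
  LocalUniformization3 RelLocalUniformization CossartPiltant2019General)
open Summit.ResolutionOfSingularities.ResolutionOfSingularities.Theorems.SteerRankThinness
  (HasProperCoarsening concl_of_hasProperCoarsening rankOne_of_not_hasProperCoarsening)
open Summit.ResolutionOfSingularities.ResolutionOfSingularities.Theorems.PfaffLine

set_option linter.dupNamespace false

namespace Summit.ResolutionOfSingularities.ResolutionOfSingularities.Theorems.SwitchingDichotomy.Words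

/-- **LANDED (p166845; shared with line `birth`).** Zero-dimensional reduction keeping the ground field
perfect. [cite: ZariskiSamuel1960, Ch. VI §17; NovacoskiSpivakovsky2014] -/
theorem stub_zeroDimPerfect : Sig.stub_zeroDimPerfect :=
  Summit.ResolutionOfSingularities.ResolutionOfSingularities.Theorems.SwitchingDichotomy.stub_zeroDimPerfect

/-- **LANDED (p169091 = `switchingDefectlessSeq`, composed of p167176, p166601, p166891, p168347).**
Strongly switching ∧ parameter-archimedean ∧ defectless ⇒ torsor LU. [cite: HeinzerEtAl2015, Prop. 4.4]
[cite: Kato1994, (10.4)] -/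
theorem stub_switchingDefectless : Sig.stub_switchingDefectless :=
  fun p hp k K _ _ _ _ O A₀ h₀ t hfg htp hfr hreg hSS hAr hnd =>
    Summit.ResolutionOfSingularities.ResolutionOfSingularities.Theorems.SwitchingDichotomy.switchingDefectlessSeq
      p hp k K O A₀ h₀ t hfg htp hfr hreg hSS hAr hnd

/-- The old debt is one line from the tree's named fact `CossartPiltant2019LU3` (LU in dimension `≤ 3` over
every field). [cite: CossartPiltant2019, Thm. 1.1 with §4.1 (LU)] -/
theorem stub_lu3Perfect_of_cossartPiltant2019LU3
    (h : Literature.AlgebraicGeometry.Resolution.CossartPiltant2019LU3.{0}) : Sig.stub_lu3Perfect :=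
  fun _ _ k _ _ _ => h k

/-- **LANDED (r9: res-L0-w41-stub-2, p473559, `Theorems/FrobeniusClosingSteerCore4RunTrichotomy.lean`) — the quadratic
sequence and the greedy torsor run.** See `Sig.stub_core4RunTrichotomy`. [folklore] -/
theorem stub_core4RunTrichotomy : Sig.stub_core4RunTrichotomy :=
  fun p k K _ _ _ O A₀ h₀ t htp hreg hdim2 =>
    Summit.ResolutionOfSingularities.ResolutionOfSingularities.Theorems.SwitchingDichotomy.stub_core4RunTrichotomy
      p k K O A₀ h₀ t htp hreg hdim2

/-- **LANDED (r10: res-L0-w41-stub-3, p479657, `Theorems/FrobeniusClosingSteerCore4OrderOneExit.lean`) — the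
order-one exit.** See `Sig.stub_core4OrderOneExit`.
[cite: HeinzerEtAl2015, Prop. 4.4] [folklore] -/
theorem stub_core4OrderOneExit : Sig.stub_core4OrderOneExit :=
  fun p hp k K _ _ _ _ O A₀ h₀ t hfg htp hfr hreg R hR0 hq s N hs h1 =>
    Summit.ResolutionOfSingularities.ResolutionOfSingularities.Theorems.SwitchingDichotomy.orderOneExit
      p hp k K O A₀ h₀ t hfg htp hfr hreg R hR0 hq s N hs h1

/-! ### r13/r14 — the pieces of the phase machine: P1 `GenExit` and P2⁰ `GenRebase` DISCHARGED by name (lead-1 g3,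
`Theorems/FrobeniusClosingSteerCore4GenExit.lean`), P0 `MaxGenExists` DISCHARGED (stub-10, p496225); P1ᴸ, Φ3ᴸˢ, Φ4ᴸˢ,
`NonSwitchingCore` REGISTERED -/

/-- **DISCHARGED (r14: res-D-pv-004 AS res-L0-w41-stub-10, p496225,
`Theorems/FrobeniusClosingSteerMaxGenExists.lean`, `MaxGenExists.exists_isMaxGenAt_of_sequence`) — P0 `MaxGenExists`:**
maximal simple orders containing `t` exist over every member (finite integral closure of `R M` in `K` + ACC).
[cite: Liu2002, Prop. 4.1.27, p. 122] [cite: Matsumura1987, §32] -/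
theorem stub_maxGenExists : MaxGenExists := by
  intro p hp n _ k K _ _ _ _ _ O A₀ h₀ t core R hR0 hRq M
  obtain ⟨hfg, htp, hfr, -⟩ := core
  exact Summit.ResolutionOfSingularities.ResolutionOfSingularities.Theorems.SwitchingDichotomy.MaxGenExists.exists_isMaxGenAt_of_sequence
    k K O A₀ h₀ hfg hp.ne_zero htp hfr R hR0 hRq M


/-- **DISCHARGED (r13: lead res-L0-w41-lead-1 g3, `Theorems.SwitchingDichotomy.genRebase`,
`Theorems/FrobeniusClosingSteerCore4GenExit.lean`) — P2⁰ `GenRebase`, every generator over every member re-bases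
the datum.** [cite: NovacoskiSpivakovsky2014, Lemma 2.5] [folklore] -/
theorem genRebase_holds : GenRebase :=
  fun p k K _ _ _ O A₀ h₀ t hfg htp hfr hreg R hR0 hRq M s' hsp ht =>
    Summit.ResolutionOfSingularities.ResolutionOfSingularities.Theorems.SwitchingDichotomy.genRebase p k K O A₀ h₀
      t hfg htp hfr hreg R hR0 hRq M s' hsp ht

/-- **DISCHARGED (r22: res-D-pv-014 AS res-L0-w41-stub-9's LEAF `LogFinal.logFinalExitM`, p503597,
`Theorems/FrobeniusClosingSteerLogFinalExitM.lean`) — L `LogFinalExitM`, idea-2's model form of the log-final exits.** Assembly of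
record (all by name): E2 ↦ `LogFinal.toroidalExitM` (res-L0-w41-stub-1, p498933, over `DegreePTransfer` p497399 and
`stub_switchingExit`); E1 ↦ `ContentFrame.exists_frame_locAtCentre` (stub-9, p499709/p500897: commuting `p`-nilpotent frame of
`ker (d f / h)`, Kunz determination) → `IteratedSlice.isRegularLocalRing_and_free_of_commuting_slices` (res-D-pv-010, p500081:
the joint kernel `B` is regular, `S` free of rank `p ^ n` over it; `n − 1`… iterations of Posva's rank-one lemma, F-E1) →
`ConstantsPthPowers.mem_iff` (stub-1, p501888: `B = S ∩ K^p`, degree count with `PDegreeSeparablyGenerated` p497884 (res-D-pv-004) and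
`PDegreeAtCentre` p503382) → `Sandwich.sandwichModel_of_isFractionRing_adjoin` (res-L0-w41-stub-3, p501175: `C = {c | c^p ∈ S}` is
regular) → `IntegralClosureModel.concl_of_pthRootClosure` (lead-1, p500853: the integral closure is a finitely generated regular
model). [cite: Posva2023, Lemma 9] [cite: Liu2002, Prop. 4.1.27, p. 122] -/
theorem stub_logFinalExitM : ∀ p : ℕ, LogFinalExitM p :=
  fun p => Summit.ResolutionOfSingularities.ResolutionOfSingularities.Theorems.SwitchingDichotomy.LogFinal.logFinalExitM p

/-- **P1ᴸ `LogExit` DERIVED (r16)** from the registered `stub_logFinalExitM`: the log-final member `R M` is the centre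
ring of the finitely generated model `A'` of `GenRebase` at the generator `s' := t` (LANDED `genRebase`, p495493), whose
elements are fractions of `A₀` (`sequence_le_subfield`), and which is regular at the centre; then idea-2's model form
concludes. Pure bookkeeping. OURS. [folklore] -/
theorem stub_logExit : LogExit := by
  intro p hp n _ k K _ _ _ _ _ O A₀ h₀ t core R hR0 hRq M hM
  classical
  obtain ⟨hfg, htp, hfr, hreg, -, hzd, -⟩ := core
  -- `t` is a generator over the member `R M`
  have htRM : t ^ p ∈ R M :=
    member_monotone O R hRq (Nat.zero_le M)
      (by rw [hR0]; exact Literature.AlgebraicGeometry.Resolution.le_locAtCentre A₀.toSubring O htp)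
  have ht : t ∈ Subring.closure (insert t (R M : Set K)) := Subring.subset_closure (Set.mem_insert t _)
  obtain ⟨A', h', hA₀A', hRM', hfg', -, -, -, hreg', -⟩ :=
    genRebase_holds p k K O A₀ h₀ t hfg htp hfr hreg R hR0 hRq M t htRM ht
  -- the model lies in `R M ⊆ Frac A₀`
  have hF0 : R 0 ≤ (Subfield.closure ((A₀.toSubring : Subring K) : Set K)).toSubring := by
    rw [hR0]
    exact Summit.ResolutionOfSingularities.ResolutionOfSingularities.Theorems.SwitchingDichotomy.locAtCentre_le_subfield
      O fun x hx => Subfield.subset_closure hx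
  have hRF := Summit.ResolutionOfSingularities.ResolutionOfSingularities.Theorems.SwitchingDichotomy.sequence_le_subfield
    hF0 hRq M
  have hA'R : A'.toSubring ≤ R M := by
    rw [← hRM']
    exact Literature.AlgebraicGeometry.Resolution.le_locAtCentre A'.toSubring O
  have hfrac : ∀ x ∈ A', IsFracOf A₀ x := fun x hx => by
    obtain ⟨y, hy, z, hz, hz0, hxyz⟩ :=
      Summit.ResolutionOfSingularities.ResolutionOfSingularities.Theorems.SwitchingDichotomy.exists_div_eq_of_mem_subfieldClosure
        (hRF (hA'R hx))
    exact ⟨y, hy, z, hz, hz0, hxyz⟩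
  -- the member is the centre ring of `A'`: transport the log-final presentation and regularity
  rw [← hRM'] at hM
  obtain ⟨hloc, hLF⟩ := hM
  exact stub_logFinalExitM p k K O A₀ A' h₀ t hp hfg htp hfr hreg hA₀A' hfg' hfrac h' hzd hloc
    ((Literature.AlgebraicGeometry.Resolution.isRegularLocalRing_locAtCentre_iff h').mpr hreg') hLF

/-! ### r13 — the landed range cascade at ONE datum (the body of `Steer_of`, steps (2)–(8), as a lemma): a datum of
transcendence degree `n` along a zero-dimensional `O` over a perfect field either has a regular model by a LANDED
range theorem (Abhyankar place / discrete rank one / birational exit / base dimension `≤ 2` / unit derivative /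
dense-Abhyankar / strongly switching ∧ parameter-archimedean ∧ defectless) or satisfies ALL fourteen core binders.
This is what lets the composition re-base at an arbitrary generator (`GenRebase`) without transferring binders. -/

/-- **Concl ∨ CoreDatum** at one datum, by the landed ranges. Pure case analysis over tree theorems. OURS. [folklore] -/
theorem concl_or_coreDatum (p : ℕ) (hp : p.Prime) (n : ℕ) (k K : Type) [Field k] [CharP k p] [PerfectField k]
    [Field K] [Algebra k K] (O : ValuationSubring K) (A₀ : Subalgebra k K) (h₀ : A₀.toSubring ≤ O.toSubring)
    (t : K) (htr : Algebra.trdeg k K = (n : Cardinal)) (hzd : ZeroDim k O) (hfg : A₀.FG) (htp : t ^ p ∈ A₀)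
    (hfr : IsFractionRing (Algebra.adjoin k (insert t (A₀ : Set K))) K)
    (hreg : IsRegularLocalRing (Localization.AtPrime
      (Ideal.comap (Subring.inclusion h₀) (IsLocalRing.maximalIdeal O)))) :
    Concl O A₀ t ∨ CoreDatum p n k K O A₀ h₀ t := by
  classical
  -- Abhyankar places over a perfect ground field (KK05, landed)
  by_cases hA : IsAbhyankarPlace O (algebraMap k K).fieldRange ⊤
  · exact Or.inl (luAlphaPTorsor_of_isAbhyankarPlace_of_perfectField p hp k K O A₀ h₀ t hfg htp hfr hA)
  -- discrete rank one, every dimension (landed)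
  by_cases hD : Discrete O
  · exact Or.inl (luAlphaPTorsor_of_discrete p hp k K O A₀ h₀ t hfg htp hfr hreg hD)
  -- the birational exit: `t ^ p` is a `p`-th power at the centre (landed)
  by_cases hpow : ∃ c : Localization.AtPrime (Ideal.comap (Subring.inclusion h₀)
      (IsLocalRing.maximalIdeal O)), algebraMap A₀.toSubring (Localization.AtPrime
        (Ideal.comap (Subring.inclusion h₀) (IsLocalRing.maximalIdeal O))) ⟨t ^ p, htp⟩ = c ^ p
  · exact Or.inl (stub_birationalExit p hp k K O A₀ h₀ t hfg htp hfr hreg hpow)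
  push Not at hpow
  -- base dimension ≤ 2 at the centre (Giraud along ν, landed)
  by_cases hdim2 : ringKrullDim (Localization.AtPrime (Ideal.comap (Subring.inclusion h₀)
      (IsLocalRing.maximalIdeal O))) ≤ 2
  · exact Or.inl (luAlphaPTorsor_of_ringKrullDim_le_two p hp k K O A₀ h₀ t hfg htp hfr hreg hdim2)
  -- a unit ℤ-derivative of the radicand: the monogenic exit (landed)
  by_cases hδ : ∃ δ : Derivation ℤ (Localization.AtPrime (Ideal.comap (Subring.inclusion h₀)
      (IsLocalRing.maximalIdeal O))) (Localization.AtPrime (Ideal.comap (Subring.inclusion h₀)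
      (IsLocalRing.maximalIdeal O))), IsUnit (δ (algebraMap A₀.toSubring (Localization.AtPrime
        (Ideal.comap (Subring.inclusion h₀) (IsLocalRing.maximalIdeal O))) ⟨t ^ p, htp⟩))
  · exact Or.inl (luAlphaPTorsor_of_isUnit_derivation p hp k K O A₀ h₀ t hfg htp hfr hreg hδ)
  push Not at hδ
  -- `K` dense in a finitely generated Abhyankar subfunction field (KK09 Thm. 1.5, landed)
  by_cases hdense : DenseAbhyankar k O
  · exact Or.inl (denseRange3_crux p hp k K O A₀ h₀ t hfg htp hfr hzd hdense)
  -- the centre of a zero-dimensional valuation is a closed point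
  have hmax : (Ideal.comap (Subring.inclusion h₀) (IsLocalRing.maximalIdeal O)).IsMaximal :=
    isMaximal_centre_of_zeroDim O hzd A₀ h₀
  -- strongly switching ∧ parameter-archimedean ∧ defectless (this line's landed range)
  by_cases hS : StronglySwitching O A₀ ∧ ArchSeq O A₀ ∧ ¬ Defect O A₀ t p
  · exact Or.inl (stub_switchingDefectless p hp k K O A₀ h₀ t hfg htp hfr hreg hS.1 hS.2.1 hS.2.2)
  -- otherwise: the defect core, all binders in hand
  exact Or.inr ⟨hfg, htp, hfr, hreg, hmax, hzd, hdim2, hA, hdense, hD, hδ, hpow, htr, hS⟩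

end Summit.ResolutionOfSingularities.ResolutionOfSingularities.Theorems.SwitchingDichotomy.Words
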